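/-
Origin: written from primary sources — A. Borel, H. Jacquet, *Automorphic forms and automorphic representations*,
Proc. Sympos. Pure Math. 33.1 (1979) §4.1 (archimedean components of adelic groups; the maximal compact subgroup);
S. Helgason, *Differential Geometry, Lie Groups, and Symmetric Spaces* (1978) Ch. VIII §7 (isotropy representation);
A. Weil, Acta Math. 111 (1964) Chap. III n° 37 (Weil representation of a dual pair on the product group). Adapted:
no. This file assembles, for a hermitian `3 × 3` matrix `H` over a CM field `L` and a distinguished embedding
`τ : L → ℂ` with frame `T` (`Tᴴ τ(H) T = diag(1,1,-1)`), the archimedean isotropy subgroup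
`K_∞ = π_τ⁻¹(Stab(x₀)) ≤ U(H)(L ⊗ ℝ)` (tree `archProjU21EmbCM`), its `∧²𝔭₊`-character (tree
`BallModel.isotropyDetChar` through `π_τ`), its embedding into the adelic points, and the resulting `κ`-ISOTYPIC
SUBSPACE of any representation of `U(H)(𝔸) × G′` (tree `weightSpace`) with its stability under `1 × G′`. Kernel only.
-/
import Literature.NumberTheory.Automorphic.UnitaryGroupArchProjectionEmb
import Literature.Geometry.ComplexHyperbolic.UnitBallIsotropyCharacter
import Literature.RepresentationTheory.CharacterIsotypicSubspace
import HarnessLib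

/-!
# The archimedean isotropy group `K_∞ ≤ U(H)(L ⊗ ℝ)`, its `∧²𝔭₊ ⊠ 𝟏` character, and the `κ`-isotypic subspace

For `L` CM, `H ∈ M₃(L)` hermitian, `τ : L →+* ℂ` and a frame `T` of `τ(H)` (`formCongr conj T (H.map τ) = J`):

* `archIsotropy L H τ T hT : Subgroup (arch L⁺ L c 3 H)` — `K_∞ := π_τ⁻¹(Stab(x₀))`, the preimage of the isotropy
  group of the base point of the ball under the archimedean projection `π_τ = archProjU21EmbCM L H τ T hT` onto
  `U(2,1)`; it CONTAINS `ker π_τ` = the product of the factors at the other places (`ker_le_archIsotropy`), so a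
  character of `K_∞` through `π_τ` is automatically `⊠ 𝟏` there;
* `archIsotropyProj : K_∞ →* Stab(x₀)` and **`archKappa : K_∞ →* ℂˣ`**, `k ↦ det D(π_τ k)(x₀)` — the character
  `κ = ∧²𝔭₊ ⊠ 𝟏` of PerL's isolation step (with `archKappaInv` for the dual convention); `coe_archKappa`,
  `archKappa_eq_one_of_mem_ker`, `continuous_archKappa`;
* `archIsotropyToAdelic : K_∞ →* U(H)(𝔸_{L⁺})` (`archToAdelic` restricted), continuous;
* for a representation `ρ` of `A × G′` and a homomorphism `e : U(H)(𝔸) →* A` (currency conversion):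
  **`kappaIsotypic ρ e χ := weightSpace ρ (fun k : K_∞ => (e (archIsotropyToAdelic k), 1)) (fun k => (χ k : ℂ))`**
  — the `χ`-isotypic subspace for `K_∞ × 1`, `χ = archKappa` or `archKappaInv` — and
  **`kappaIsotypic_stable_inr`**: every `ρ (1, h)` preserves it (the `SK_stable` clause of
  `Weil1964.ThetaKernelDatum.adelicOfDualPair`, `weightSpace_stable_inr`).

Everything is definitional assembly of landed tree declarations plus `weightSpace_stable_inr`; no records.
-/

set_option autoImplicit false

noncomputable section

open NumberField MulAction

namespace Literature.NumberTheory.Automorphic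

namespace UnitaryGroup

open Literature.Geometry.ComplexHyperbolic Literature.Geometry.ComplexHyperbolic.BallModel
open Literature.RepresentationTheory

variable (L : Type) [Field L] [NumberField L] [IsCMField L] (H : Matrix (Fin 3) (Fin 3) L)
  (τ : L →+* ℂ) (T : GL (Fin 3) ℂ) (hT : formCongr (starRingEnd ℂ) T (H.map τ) = BallModel.J)

/-! ### `K_∞` and its character -/

/-- **The archimedean isotropy subgroup `K_∞ := π_τ⁻¹(Stab(x₀)) ≤ U(H)(L ⊗ ℝ)`** (maximal compact at the place of
`τ`, everything at the other places). [cite: BorelJacquet1979, §4.1] -/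
def archIsotropy : Subgroup (arch (↥(maximalRealSubfield L)) L (IsCMField.complexConj L) 3 H) :=
  (stabilizer U21 x₀).comap (archProjU21EmbCM L H τ T hT)

/-- Membership: `g ∈ K_∞ ↔ π_τ g` fixes the base point `x₀` of the ball. [folklore] -/
theorem mem_archIsotropy_iff (g : arch (↥(maximalRealSubfield L)) L (IsCMField.complexConj L) 3 H) :
    g ∈ archIsotropy L H τ T hT ↔ archProjU21EmbCM L H τ T hT g • x₀ = x₀ := by
  rw [archIsotropy, Subgroup.mem_comap, mem_stabilizer_iff]

/-- The factors at the other places lie in `K_∞`: `ker π_τ ≤ K_∞`. [folklore] -/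
theorem ker_le_archIsotropy : (archProjU21EmbCM L H τ T hT).ker ≤ archIsotropy L H τ T hT := fun g hg => by
  rw [mem_archIsotropy_iff, MonoidHom.mem_ker.mp hg, one_smul]

/-- `K_∞ →* Stab(x₀)`, the restriction of `π_τ`. [folklore] -/
def archIsotropyProj : archIsotropy L H τ T hT →* stabilizer U21 x₀ :=
  (archProjU21EmbCM L H τ T hT).subgroupComap (stabilizer U21 x₀)

/-- Value of the restricted projection. [folklore] -/
@[simp] theorem coe_archIsotropyProj (k : archIsotropy L H τ T hT) :
    ((archIsotropyProj L H τ T hT k : stabilizer U21 x₀) : U21) = archProjU21EmbCM L H τ T hT k := rfl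

/-- Continuity of the restricted projection. [folklore] -/
theorem continuous_archIsotropyProj : Continuous (archIsotropyProj L H τ T hT) :=
  Continuous.subtype_mk ((continuous_archProjU21EmbCM L H τ T hT).comp continuous_subtype_val) _

/-- **`κ = ∧²𝔭₊ ⊠ 𝟏` on `K_∞`**: `k ↦ det D(π_τ k)(x₀)` (tree `BallModel.isotropyDetChar` through `π_τ`).
(Helgason VIII §7; Borel–Jacquet §4.1) [folklore] -/
def archKappa : archIsotropy L H τ T hT →* ℂˣ :=
  isotropyDetChar.comp (archIsotropyProj L H τ T hT)

/-- The dual convention `κ⁻¹ = ∧²𝔭₊^* ⊠ 𝟏`. [folklore] -/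
def archKappaInv : archIsotropy L H τ T hT →* ℂˣ :=
  isotropyDetCharInv.comp (archIsotropyProj L H τ T hT)

/-- Value of `κ`. [folklore] -/
theorem coe_archKappa (k : archIsotropy L H τ T hT) :
    (archKappa L H τ T hT k : ℂ) = (Jac (archProjU21EmbCM L H τ T hT k) x₀).det := rfl

/-- `κ⁻¹ = (κ)⁻¹` pointwise. [folklore] -/
theorem archKappaInv_apply (k : archIsotropy L H τ T hT) :
    archKappaInv L H τ T hT k = (archKappa L H τ T hT k)⁻¹ := by
  rw [archKappaInv, archKappa, MonoidHom.comp_apply, MonoidHom.comp_apply, isotropyDetCharInv, MonoidHom.inv_apply]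

/-- `κ` is trivial on the factors at the other places (`ker π_τ`). [folklore] -/
theorem archKappa_eq_one_of_mem_ker (k : archIsotropy L H τ T hT)
    (hk : (k : arch (↥(maximalRealSubfield L)) L (IsCMField.complexConj L) 3 H) ∈ (archProjU21EmbCM L H τ T hT).ker) :
    archKappa L H τ T hT k = 1 := by
  have h1 : archIsotropyProj L H τ T hT k = 1 := Subtype.ext (MonoidHom.mem_ker.mp hk)
  rw [archKappa, MonoidHom.comp_apply, h1, map_one]

/-- Continuity of `κ` as a `ℂ`-valued function. [folklore] -/
theorem continuous_archKappa : Continuous fun k : archIsotropy L H τ T hT => (archKappa L H τ T hT k : ℂ) :=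
  continuous_isotropyDetChar.comp (continuous_archIsotropyProj L H τ T hT)

/-- Continuity of `κ⁻¹` as a `ℂ`-valued function. [folklore] -/
theorem continuous_archKappaInv : Continuous fun k : archIsotropy L H τ T hT => (archKappaInv L H τ T hT k : ℂ) := by
  simp only [archKappaInv_apply, Units.val_inv_eq_inv_val]
  exact (continuous_archKappa L H τ T hT).inv₀ fun k => (archKappa L H τ T hT k).ne_zero

/-! ### Into the adelic points -/

/-- **`K_∞ →* U(H)(𝔸_{L⁺})`**, `k ↦ (k, 1)` (tree `archToAdelic` restricted). [cite: BorelJacquet1979, §4.1] -/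
def archIsotropyToAdelic :
    archIsotropy L H τ T hT →*
      (adelicGroupData (↥(maximalRealSubfield L)) L (IsCMField.complexConj L) 3 H).Adelic :=
  (archToAdelic (↥(maximalRealSubfield L)) L (IsCMField.complexConj L) 3 H).comp (archIsotropy L H τ T hT).subtype

/-- Continuity of `K_∞ → U(H)(𝔸)`. [folklore] -/
theorem continuous_archIsotropyToAdelic : Continuous (archIsotropyToAdelic L H τ T hT) :=
  (continuous_archToAdelic (↥(maximalRealSubfield L)) L (IsCMField.complexConj L) 3 H).comp continuous_subtype_val

/-! ### The `κ`-isotypic subspace of a representation of `U(H)(𝔸) × G′` and its stability -/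

section Isotypic

variable {L H τ T hT}
variable {A G' V : Type*} [Monoid A] [Monoid G'] [AddCommGroup V] [Module ℂ V]

/-- **The `χ`-isotypic subspace for `K_∞ × 1`** of a representation `ρ` of `A × G′`, `K_∞` mapped into `A` through
a currency conversion `e : U(H)(𝔸) →* A`: `{v | ∀ k ∈ K_∞, ρ (e(k,1_f), 1) v = χ k • v}` — PerL's `𝒮^κ` for
`χ = archKappa` (or `archKappaInv`). [folklore] -/
def kappaIsotypic (ρ : Representation ℂ (A × G') V)
    (e : (adelicGroupData (↥(maximalRealSubfield L)) L (IsCMField.complexConj L) 3 H).Adelic →* A)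
    (χ : archIsotropy L H τ T hT →* ℂˣ) : Submodule ℂ V :=
  weightSpace ρ (fun k : archIsotropy L H τ T hT => ((e (archIsotropyToAdelic L H τ T hT k), (1 : G')) : A × G'))
    (fun k => (χ k : ℂ))

/-- Membership in the isotypic subspace. [folklore] -/
theorem mem_kappaIsotypic_iff (ρ : Representation ℂ (A × G') V)
    (e : (adelicGroupData (↥(maximalRealSubfield L)) L (IsCMField.complexConj L) 3 H).Adelic →* A)
    (χ : archIsotropy L H τ T hT →* ℂˣ) (v : V) :
    v ∈ kappaIsotypic ρ e χ ↔
      ∀ k : archIsotropy L H τ T hT, ρ (e (archIsotropyToAdelic L H τ T hT k), 1) v = (χ k : ℂ) • v :=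
  mem_weightSpace

/-- **Stability under the second factor** (the `SK_stable` clause of `Weil1964.ThetaKernelDatum.adelicOfDualPair`):
every `ρ (1, h)` maps the `χ`-isotypic subspace into itself. [folklore] -/
theorem kappaIsotypic_stable_inr (ρ : Representation ℂ (A × G') V)
    (e : (adelicGroupData (↥(maximalRealSubfield L)) L (IsCMField.complexConj L) 3 H).Adelic →* A)
    (χ : archIsotropy L H τ T hT →* ℂˣ) (h : G') (v : V) (hv : v ∈ kappaIsotypic ρ e χ) :
    ρ (1, h) v ∈ kappaIsotypic ρ e χ :=
  weightSpace_stable_inr h hv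

/-- `Set`-level form of the stability, literally the hypothesis shape
`∀ h Φ, Φ ∈ SK → ρ (1, h) Φ ∈ SK`. [folklore] -/
theorem kappaIsotypic_stable_inr' (ρ : Representation ℂ (A × G') V)
    (e : (adelicGroupData (↥(maximalRealSubfield L)) L (IsCMField.complexConj L) 3 H).Adelic →* A)
    (χ : archIsotropy L H τ T hT →* ℂˣ) :
    ∀ (h : G') (v : V), v ∈ (kappaIsotypic ρ e χ : Set V) → ρ (1, h) v ∈ (kappaIsotypic ρ e χ : Set V) :=
  fun h v hv => kappaIsotypic_stable_inr ρ e χ h v hv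

end Isotypic

end UnitaryGroup

end Literature.NumberTheory.Automorphic

end
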